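import Summits.QuantumFields.YangMills.Theses.SqueezedSkewness
import Summits.QuantumFields.YangMills.Theorems.SqueezedSkewnessCovPolarisation
import Summits.QuantumFields.YangMills.Theorems.SqueezedSkewnessLowPassDFT
import Summits.QuantumFields.YangMills.Theorems.SqueezedSkewnessLatticeSumFloor
import Summits.QuantumFields.YangMills.Theorems.SqueezedSkewnessHBBumps
import Summits.QuantumFields.YangMills.Theorems.SqueezedSkewnessVacuumDominationKLGlue
import Summits.QuantumFields.YangMills.Theorems.SqueezedSkewnessTorusFloorsKit
import Summits.QuantumFields.YangMills.Theorems.SqueezedSkewnessTorusFloorsBumps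

/-!
# `SqueezedSkewness.TorusFloorsGlue` — PROVED (support stmt-QuantumFields-23206; LINE α «torus-direct Källén–Lehmann» of
# planner ym-idea-6 g10): `LowPassFloorH → KLCoherence → TorusKL → AntipodalMirrorCeiling → DivisibleBump → PointlikeHypercubeFloors`

PROOF.  Take the unit `(r, a)` and `ε, β₅, Λ₅` from `LowPassFloorH`; `AntipodalMirrorCeiling` at `η = ε/8` gives `β₆, Λ₆`.  For a
radius `ρ > 0` take `(v, f, c, s₀)` from `DivisibleBump` and the lattice-sum floor `c₀ ≤ s⁴Σ_x f(sx)` (`s ≤ a₀`) of the high-ball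
bump `f`.  For `β ≥ max(β₅, β₆, β₇, 0)` (`a(β) ≤ min(s₀, a₀, 1)`) and `a(β)L ≥ max(Λ₅, Λ₆, 8 + ρ)` put `s = a(β)`, `T = 2L+1`,
`m = ⌊5/(2s)⌋`, `H = ⌊T/4⌋` (`m + 1 ≤ H`, `H + 2 ≤ L`).  `TorusKL` on the FIXED hypercube `T⁴` gives ONE family `(W ≥ 0, μ ≥ 0, q)`
— image atoms `μ > 1` included — with `HasSum`s for `v`, for the Schwartz interpolants `φ ± ψ` of the route's weights `ind`/`kap` at
height `m + 1` (tree `SqueezedSkewnessHBBumps`, `lowPass_dft`: `amp φ = μ^m`, `amp ψ = μ^m·1[lp]`) and for the bump `φ_H` at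
height `H` (`amp φ_H = μ^{H−1}`): by polarisation (`cov_refl_polarisation`) `HasSum (W μ^{2m} 1[lp]) M_T`, `M_T ≥ ε s⁸` (floor), and
`HasSum (W μ^{2(H−1)}) N_T`, `N_T ≤ (ε/8) s⁸` (ceiling).  On the PHYSICAL atoms `μₙ ≤ 1`: `KLCoherence` gives
`½ μₙ^{2m} 1[lp] (Σ_x f(sx))² ≤ |amp f|²` and `DivisibleBump` (through the tree's `amp_dom`) `c²|amp f|² ≤ |amp v|²`; the image
atoms of the floor are dominated by the mirror atom (`μ^{2m} ≤ μ^{2(H−1)}` for `μ > 1`).  The kit's `glue_abstract_torus` assembles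
`Qrp_T(v) ≥ c²(Σ_x f(sx))²(M_T − N_T)/2 ≥ (7/16)c²c₀²ε ≥ c²c₀²ε/4`.  The route's `Qrp`, `M`, `N`, `amp` are handled through opaque
local functionals (`QQ`, `CF`, `AMP`) fixed by definitional unfolding, as in the LINE-2 twin `HighBallFloorsLPGlue`.
HONEST SCOPE: plumbing of a LINE onto `BalabanLadder.NT` (R2a); the cruxes `LowPassFloorH`, `TorusKL`, `AntipodalMirrorCeiling`
remain hypotheses; nothing about NT or the YM mass gap is proved.  No definitions.  Width seat ym-line-sfw-p2-w5 g10 (free hands).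
[folklore]
-/

noncomputable section

open scoped BigOperators
open MeasureTheory Filter Topology Set Metric Finset Complex
open Literature.MathematicalPhysics.QuantumLattice
open Literature.MathematicalPhysics.QuantumFieldTheory
open Summit.QuantumFields.YangMills.Theorems.ThermalDescentReflection
open Summit.QuantumFields.YangMills.Theorems.SqueezedSkewnessCovPolar
open Summit.QuantumFields.YangMills.Theorems.SqueezedSkewnessLowPassDFT
open Summit.QuantumFields.YangMills.Theorems.SqueezedSkewnessLatticeSumFloor
open Summit.QuantumFields.YangMills.Theorems.SqueezedSkewnessLatticeBumps
open Summit.QuantumFields.YangMills.Theorems.SqueezedSkewnessHBAmps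
open Summit.QuantumFields.YangMills.Theorems.SqueezedSkewnessHBBumps
open Summit.QuantumFields.YangMills.Theorems.SqueezedSkewnessVacuumDominationKLGlue (amp_dom)
open Summit.QuantumFields.YangMills.Theorems.SqueezedSkewnessTorusFloorsKit
open Summit.QuantumFields.YangMills.Theorems.SqueezedSkewnessTorusFloorsBumps

namespace Summit.QuantumFields.YangMills.Theorems.SqueezedSkewnessTorusFloorsGlue

/-- **`TorusFloorsGlue` (stmt-QuantumFields-23206) HOLDS**:
`LowPassFloorH → KLCoherence → TorusKL → AntipodalMirrorCeiling → DivisibleBump → PointlikeHypercubeFloors`.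
Plumbing of a line onto `BalabanLadder.NT`; no summit statement is affected. [folklore] -/
theorem torusFloorsGlue_proof :
    Summit.QuantumFields.YangMills.Theses.SqueezedSkewness.TorusFloorsGlue := by
  intro hLP hKL hTK hAM hDB G i1 i2 i3 i4 hG
  obtain ⟨r, a, hLP'⟩ := hLP G hG
  refine ⟨r, a, ?_⟩
  dsimp only at hLP' ⊢
  obtain ⟨ha, ha0, ε, β₅, Λ₅, hε, hfloor⟩ := hLP'
  refine ⟨ha, ha0, fun ρ hρ => ?_⟩
  letI : MeasurableSpace G := borel G
  haveI : BorelSpace G := ⟨rfl⟩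
  haveI : SecondCountableTopology G :=
    (r.continuous.isClosedEmbedding r.injective).isEmbedding.secondCountableTopology
  -- the antipodal mirror ceiling at `η = ε/8`
  have hAM' := hAM G hG r a ha ha0
  dsimp only at hAM'
  obtain ⟨β₆, Λ₆, hceil⟩ := hAM' ⟨ε, β₅, Λ₅, hε, hfloor⟩ (ε / 8) (by positivity)
  -- the divisible bump of radius `ρ`
  obtain ⟨v, f, hv0, hvball, ⟨δ₁, δ₂, hδ₁, hvslab⟩, hf0, hfne, hfball, c, s₀, hc, hs₀, hdom⟩ := hDB ρ hρ
  have hfne' : (f : EuclideanSpace ℝ (Fin 4) → ℝ) ≠ 0 := by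
    intro h; apply hfne; ext y; simpa using congrFun h y
  obtain ⟨hfR, hvR, hf_pos, hv_pos, hvslab1, hvcube⟩ := bump_supports hρ.le hfball hvball hvslab hδ₁
  obtain ⟨c₀, a₀, hc₀, ha₀, hfl⟩ := lattice_sum_floor f.continuous hf0 hfR hfne'
  obtain ⟨β₇, hβ₇⟩ : ∃ β₇ : ℝ, ∀ β, β₇ ≤ β → a β < min s₀ (min a₀ 1) := by
    have h1 : ∀ᶠ β in atTop, a β < min s₀ (min a₀ 1) :=
      ha0.eventually (gt_mem_nhds (lt_min hs₀ (lt_min ha₀ one_pos)))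
    exact Filter.eventually_atTop.mp h1
  refine ⟨v, hv0, hvball, δ₁, δ₂, c ^ 2 * c₀ ^ 2 * ε / 4, max β₅ (max β₆ (max β₇ 0)),
    max Λ₅ (max Λ₆ (8 + ρ)), hδ₁, hvslab, by positivity, ?_⟩
  intro β hβ L hL
  simp only [max_le_iff] at hβ hL
  obtain ⟨hβ5, hβ6, hβ7, hβ0⟩ := hβ
  obtain ⟨hΛ5, hΛ6, hΛρ⟩ := hL
  have hs : 0 < a β := ha β
  have hss₀ : a β ≤ s₀ := (hβ₇ β hβ7).le.trans (min_le_left _ _)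
  have hsa : a β ≤ a₀ := ((hβ₇ β hβ7).le.trans (min_le_right _ _)).trans (min_le_left _ _)
  have hs1 : a β ≤ 1 := ((hβ₇ β hβ7).le.trans (min_le_right _ _)).trans (min_le_right _ _)
  have h8 : 8 ≤ a β * L := by linarith
  have hL8 : (8 : ℝ) ≤ L := le_trans h8 (mul_le_of_le_one_left (Nat.cast_nonneg L) hs1)
  have hL5 : 5 ≤ L := by exact_mod_cast (show (5 : ℝ) ≤ L by linarith)
  have hL1 : 1 ≤ L := by omega
  set s : ℝ := a β with hs_def
  have hS : 0 < 2 * L + 1 := by omega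
  set m : ℕ := ⌊5 / (2 * s)⌋₊ with hm_def
  set H : ℕ := (2 * L + 1) / 4 with hH_def
  obtain ⟨hmH, hm3⟩ := lowPass_height_bounds hs hs1 L h8
  obtain ⟨hH4, hH1, hH2⟩ := antipodal_height_bounds L hL5
  -- the floor and the ceiling on this hypercube
  have hfk := hfloor β hβ5 L hΛ5
  have hck := hceil β hβ6 L hΛ6
  -- the Källén–Lehmann family of the hypercube `(2L+1)⁴`
  have hTK' := hTK G r
  dsimp only at hTK'
  obtain ⟨W, μ, q, hW, hμ, hspec⟩ := hTK' β L (2 * L + 1) s hβ0 hL1 (by omega) hs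
  have hKL' := hKL
  unfold Summit.QuantumFields.YangMills.Theses.SqueezedSkewness.KLCoherence at hKL'
  dsimp only at hKL'
  -- opaque local functionals
  obtain ⟨QQ, hQQ⟩ : ∃ QQ : (FinTorusSite (2 * L + 1) (2 * L + 1) (2 * L + 1) (2 * L + 1) → ℝ) →
      (FinTorusSite (2 * L + 1) (2 * L + 1) (2 * L + 1) (2 * L + 1) → ℝ) → ℝ, ∀ c₁ c₂, QQ c₁ c₂ =
      (∫ U : FinTorusSite (2 * L + 1) (2 * L + 1) (2 * L + 1) (2 * L + 1) × Fin 4 → G,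
          (∑ x : FinTorusSite (2 * L + 1) (2 * L + 1) (2 * L + 1) (2 * L + 1), c₁ x *
              ∑ q : {q : Fin 4 × Fin 4 // q.1 < q.2}, (r.ρ (finTorusPlaquette
                (fun e => if e.2 = Fin.last 3 then (U ((e.1.1, e.1.2.1, e.1.2.2.1, Fin.rev e.1.2.2.2), Fin.last 3))⁻¹
                  else U ((e.1.1, e.1.2.1, e.1.2.2.1, ⟨((2 * L + 1) - e.1.2.2.2.val) % (2 * L + 1),
                    Nat.mod_lt _ e.1.2.2.2.pos⟩), e.2))
                x q.1.1 q.1.2)).trace.re) *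
            (∑ x : FinTorusSite (2 * L + 1) (2 * L + 1) (2 * L + 1) (2 * L + 1), c₂ x *
              ∑ q : {q : Fin 4 × Fin 4 // q.1 < q.2}, (r.ρ (finTorusPlaquette U x q.1.1 q.1.2)).trace.re) *
          Real.exp (-β * ∑ x : FinTorusSite (2 * L + 1) (2 * L + 1) (2 * L + 1) (2 * L + 1),
            ∑ q : {q : Fin 4 × Fin 4 // q.1 < q.2}, ((r.N : ℝ) - (r.ρ (finTorusPlaquette U x q.1.1 q.1.2)).trace.re))
          ∂Measure.pi (fun _ => haarProbability G)) /
        wilsonFinTorusPartition r.ρ β (2 * L + 1) (2 * L + 1) (2 * L + 1) (2 * L + 1) -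
      (∫ U : FinTorusSite (2 * L + 1) (2 * L + 1) (2 * L + 1) (2 * L + 1) × Fin 4 → G,
          (∑ x : FinTorusSite (2 * L + 1) (2 * L + 1) (2 * L + 1) (2 * L + 1), c₁ x *
              ∑ q : {q : Fin 4 × Fin 4 // q.1 < q.2}, (r.ρ (finTorusPlaquette
                (fun e => if e.2 = Fin.last 3 then (U ((e.1.1, e.1.2.1, e.1.2.2.1, Fin.rev e.1.2.2.2), Fin.last 3))⁻¹
                  else U ((e.1.1, e.1.2.1, e.1.2.2.1, ⟨((2 * L + 1) - e.1.2.2.2.val) % (2 * L + 1),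
                    Nat.mod_lt _ e.1.2.2.2.pos⟩), e.2))
                x q.1.1 q.1.2)).trace.re) *
          Real.exp (-β * ∑ x : FinTorusSite (2 * L + 1) (2 * L + 1) (2 * L + 1) (2 * L + 1),
            ∑ q : {q : Fin 4 × Fin 4 // q.1 < q.2}, ((r.N : ℝ) - (r.ρ (finTorusPlaquette U x q.1.1 q.1.2)).trace.re))
          ∂Measure.pi (fun _ => haarProbability G)) /
        wilsonFinTorusPartition r.ρ β (2 * L + 1) (2 * L + 1) (2 * L + 1) (2 * L + 1) *
      ((∫ U : FinTorusSite (2 * L + 1) (2 * L + 1) (2 * L + 1) (2 * L + 1) × Fin 4 → G,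
          (∑ x : FinTorusSite (2 * L + 1) (2 * L + 1) (2 * L + 1) (2 * L + 1), c₂ x *
              ∑ q : {q : Fin 4 × Fin 4 // q.1 < q.2}, (r.ρ (finTorusPlaquette U x q.1.1 q.1.2)).trace.re) *
          Real.exp (-β * ∑ x : FinTorusSite (2 * L + 1) (2 * L + 1) (2 * L + 1) (2 * L + 1),
            ∑ q : {q : Fin 4 × Fin 4 // q.1 < q.2}, ((r.N : ℝ) - (r.ρ (finTorusPlaquette U x q.1.1 q.1.2)).trace.re))
          ∂Measure.pi (fun _ => haarProbability G)) /
        wilsonFinTorusPartition r.ρ β (2 * L + 1) (2 * L + 1) (2 * L + 1) (2 * L + 1)) := ⟨_, fun _ _ => rfl⟩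
  obtain ⟨κR, hκR⟩ : ∃ κR : Fin (2 * L + 1) × Fin (2 * L + 1) × Fin (2 * L + 1) → ℝ, ∀ z, κR z =
      (1 / ((2 * L + 1 : ℕ) : ℝ) ^ 3) * ∑ q : Fin (2 * L + 1) × Fin (2 * L + 1) × Fin (2 * L + 1),
        (if (2 / s ^ 2) * ((1 - Real.cos (2 * Real.pi * q.1.val / ((2 * L + 1 : ℕ) : ℝ))) +
            (1 - Real.cos (2 * Real.pi * q.2.1.val / ((2 * L + 1 : ℕ) : ℝ))) +
            (1 - Real.cos (2 * Real.pi * q.2.2.val / ((2 * L + 1 : ℕ) : ℝ)))) ≤ 1 then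
          Real.cos (2 * Real.pi * ((q.1.val * z.1.val + q.2.1.val * z.2.1.val + q.2.2.val * z.2.2.val : ℕ) : ℝ) /
            ((2 * L + 1 : ℕ) : ℝ)) else 0) := ⟨_, fun _ => rfl⟩
  obtain ⟨indT, hindT⟩ : ∃ indT : FinTorusSite (2 * L + 1) (2 * L + 1) (2 * L + 1) (2 * L + 1) → ℝ, ∀ x,
      indT x = if x.2.2.2.val = m + 1 ∧ x.1.val = 0 ∧ x.2.1.val = 0 ∧ x.2.2.1.val = 0 then 1 else 0 :=
    ⟨_, fun _ => rfl⟩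
  obtain ⟨indH, hindH⟩ : ∃ indH : FinTorusSite (2 * L + 1) (2 * L + 1) (2 * L + 1) (2 * L + 1) → ℝ, ∀ x,
      indH x = if x.2.2.2.val = H ∧ x.1.val = 0 ∧ x.2.1.val = 0 ∧ x.2.2.1.val = 0 then 1 else 0 :=
    ⟨_, fun _ => rfl⟩
  obtain ⟨kapT, hkapT⟩ : ∃ kapT : FinTorusSite (2 * L + 1) (2 * L + 1) (2 * L + 1) (2 * L + 1) → ℝ, ∀ x,
      kapT x = if x.2.2.2.val = m + 1 then κR (x.1, x.2.1, x.2.2.1) else 0 := ⟨_, fun _ => rfl⟩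
  have hflT : ε * s ^ 8 ≤ QQ indT kapT := by
    rw [hQQ]
    simp only [hindT, hkapT, hκR]
    exact hfk
  have hclT : QQ indH indH ≤ ε / 8 * s ^ 8 := by
    rw [hQQ]
    simp only [hindH]
    exact hck
  clear hfk hck
  have hpolT : ∀ (c₁ c₂ : FinTorusSite (2 * L + 1) (2 * L + 1) (2 * L + 1) (2 * L + 1) → ℝ),
      4 * QQ c₁ c₂ = QQ (fun x => c₁ x + c₂ x) (fun x => c₁ x + c₂ x) -
        QQ (fun x => c₁ x - c₂ x) (fun x => c₁ x - c₂ x) := by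
    intro c₁ c₂
    rw [hQQ, hQQ, hQQ]
    exact cov_refl_polarisation r.ρ β
      (wilsonFinTorusPartition r.ρ β (2 * L + 1) (2 * L + 1) (2 * L + 1) (2 * L + 1)) r.continuous
      (fun U e => if e.2 = Fin.last 3 then (U ((e.1.1, e.1.2.1, e.1.2.2.1, Fin.rev e.1.2.2.2), Fin.last 3))⁻¹
        else U ((e.1.1, e.1.2.1, e.1.2.2.1, ⟨((2 * L + 1) - e.1.2.2.2.val) % (2 * L + 1),
          Nat.mod_lt _ e.1.2.2.2.pos⟩), e.2))
      (fun U => rfl) c₁ c₂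
  obtain ⟨AMP, hAMP⟩ : ∃ AMP : SchwartzMap (EuclideanSpace ℝ (Fin 4)) ℝ → ℕ → ℂ, ∀ g n, AMP g n =
      ∑' x : Fin 4 → ℤ, (((g (s • siteToE (d := 4) x) * μ n ^ (Int.toNat (x 0 - 1))) : ℝ) : ℂ) *
        cexp (I * ((s * ∑ k : Fin 3, (2 * Real.pi * (q n k : ℝ) / (s * (2 * L + 1))) * (x k.succ : ℝ) : ℝ) : ℂ)) :=
    ⟨_, fun _ _ => rfl⟩
  obtain ⟨CF, hCF⟩ : ∃ CF : SchwartzMap (EuclideanSpace ℝ (Fin 4)) ℝ →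
      FinTorusSite (2 * L + 1) (2 * L + 1) (2 * L + 1) (2 * L + 1) → ℝ, ∀ g x, CF g x =
      g (s • siteToE (d := 4) ![(if 2 * x.2.2.2.val < 2 * L + 1 then (x.2.2.2.val : ℤ) else (x.2.2.2.val : ℤ) - (2 * L + 1 : ℕ)),
        (if 2 * x.1.val < 2 * L + 1 then (x.1.val : ℤ) else (x.1.val : ℤ) - (2 * L + 1 : ℕ)),
        (if 2 * x.2.1.val < 2 * L + 1 then (x.2.1.val : ℤ) else (x.2.1.val : ℤ) - (2 * L + 1 : ℕ)),
        (if 2 * x.2.2.1.val < 2 * L + 1 then (x.2.2.1.val : ℤ) else (x.2.2.1.val : ℤ) - (2 * L + 1 : ℕ))]) :=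
    ⟨_, fun _ _ => rfl⟩
  have hspecT : ∀ (H' : ℝ) (g : SchwartzMap (EuclideanSpace ℝ (Fin 4)) ℝ),
      2 * H' + 3 * s ≤ s * ((2 * L + 1 : ℕ) : ℝ) →
      tsupport (g : EuclideanSpace ℝ (Fin 4) → ℝ) ⊆ {y | 0 < y 0 ∧ y 0 ≤ H'} →
      tsupport (g : EuclideanSpace ℝ (Fin 4) → ℝ) ⊆ {y | ∀ i : Fin 3, |y i.succ| < s * (L + 1 / 2)} →
      HasSum (fun n => W n * ‖AMP g n‖ ^ 2) (QQ (CF g) (CF g)) := by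
    intro H' g h0 h1 h2
    simp only [hQQ, hCF, hAMP]
    exact hspec H' g h0 h1 h2
  have hCFadd : ∀ (g h : SchwartzMap (EuclideanSpace ℝ (Fin 4)) ℝ) x, CF (g + h) x = CF g x + CF h x := by
    intro g h x; simp only [hCF, add_apply]
  have hCFsub : ∀ (g h : SchwartzMap (EuclideanSpace ℝ (Fin 4)) ℝ) x, CF (g - h) x = CF g x - CF h x := by
    intro g h x; simp only [hCF, sub_apply]
  have hSR : ((2 * L + 1 : ℕ) : ℝ) = 2 * (L : ℝ) + 1 := by push_cast; ring
  have hm1 : Int.toNat (((m + 1 : ℕ) : ℤ) - 1) = m := by simp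
  have hH1' : Int.toNat (((H : ℕ) : ℤ) - 1) = H - 1 := by
    have : ((H : ℕ) : ℤ) - 1 = ((H - 1 : ℕ) : ℤ) := by omega
    rw [this, Int.toNat_natCast]
  -- the low-pass indicator and its Fourier kernel
  obtain ⟨χ, hχ⟩ : ∃ χ : Fin (2 * L + 1) × Fin (2 * L + 1) × Fin (2 * L + 1) → ℝ, ∀ q', χ q' =
      if (2 / s ^ 2) * ((1 - Real.cos (2 * Real.pi * q'.1.val / ((2 * L + 1 : ℕ) : ℝ))) +
          (1 - Real.cos (2 * Real.pi * q'.2.1.val / ((2 * L + 1 : ℕ) : ℝ))) +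
          (1 - Real.cos (2 * Real.pi * q'.2.2.val / ((2 * L + 1 : ℕ) : ℝ)))) ≤ 1 then 1 else 0 := ⟨_, fun _ => rfl⟩
  obtain ⟨κχ, hκχ⟩ : ∃ κχ : Fin (2 * L + 1) × Fin (2 * L + 1) × Fin (2 * L + 1) → ℝ, ∀ z, κχ z =
      (1 / ((2 * L + 1 : ℕ) : ℝ) ^ 3) * ∑ q' : Fin (2 * L + 1) × Fin (2 * L + 1) × Fin (2 * L + 1),
        χ q' * Real.cos (2 * Real.pi *
          ((q'.1.val * z.1.val + q'.2.1.val * z.2.1.val + q'.2.2.val * z.2.2.val : ℕ) : ℝ) / ((2 * L + 1 : ℕ) : ℝ)) :=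
    ⟨_, fun _ => rfl⟩
  have hκRχ : ∀ z, κR z = κχ z := by
    intro z; rw [hκR, hκχ]; congr 1
    refine Finset.sum_congr rfl fun q' _ => ?_
    rw [hχ]; split_ifs <;> simp
  have hχ01 : ∀ q', 0 ≤ χ q' ∧ χ q' ≤ 1 := by
    intro q'; rw [hχ]; split_ifs <;> norm_num
  have hsymm : ∀ q₁ q₂ : Fin (2 * L + 1) × Fin (2 * L + 1) × Fin (2 * L + 1),
      (2 * L + 1) ∣ q₁.1.val + q₂.1.val → (2 * L + 1) ∣ q₁.2.1.val + q₂.2.1.val →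
      (2 * L + 1) ∣ q₁.2.2.val + q₂.2.2.val → χ q₁ = χ q₂ := by
    intro q₁ q₂ h1 h2 h3
    rw [hχ, hχ, cos_dvd_add _ hS _ _ h1, cos_dvd_add _ hS _ _ h2, cos_dvd_add _ hS _ _ h3]
  obtain ⟨qb, hqb⟩ : ∃ qb : ℕ → Fin (2 * L + 1) × Fin (2 * L + 1) × Fin (2 * L + 1), ∀ n, qb n =
      (⟨((q n 0) % ((2 * L + 1 : ℕ) : ℤ)).toNat, toNat_emod_lt (2 * L + 1) hS (q n 0)⟩,
        ⟨((q n 1) % ((2 * L + 1 : ℕ) : ℤ)).toNat, toNat_emod_lt (2 * L + 1) hS (q n 1)⟩,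
        ⟨((q n 2) % ((2 * L + 1 : ℕ) : ℤ)).toNat, toNat_emod_lt (2 * L + 1) hS (q n 2)⟩) := ⟨_, fun _ => rfl⟩
  have hχqb : ∀ n, χ (qb n) =
      if (2 / s ^ 2) * ((1 - Real.cos (2 * Real.pi * ((((q n 0) % ((2 * L + 1 : ℕ) : ℤ)).toNat : ℕ) : ℝ) /
            ((2 * L + 1 : ℕ) : ℝ))) +
          (1 - Real.cos (2 * Real.pi * ((((q n 1) % ((2 * L + 1 : ℕ) : ℤ)).toNat : ℕ) : ℝ) / ((2 * L + 1 : ℕ) : ℝ))) +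
          (1 - Real.cos (2 * Real.pi * ((((q n 2) % ((2 * L + 1 : ℕ) : ℤ)).toNat : ℕ) : ℝ) / ((2 * L + 1 : ℕ) : ℝ))))
          ≤ 1 then 1 else 0 := by
    intro n; rw [hqb, hχ]
  -- the three bumps: `φ` (ind at height m+1), `ψ` (kap at height m+1), `φH` (ind at the antipodal height H)
  obtain ⟨φ, hφc, hφs, hφv, hφa⟩ := exists_bump hs ![((m + 1 : ℕ) : ℤ), 0, 0, 0]
  obtain ⟨φH, hφHc, hφHs, hφHv, hφHa⟩ := exists_bump hs ![((H : ℕ) : ℤ), 0, 0, 0]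
  choose Bz hBc hBs hBv hBa using fun z : Fin (2 * L + 1) × Fin (2 * L + 1) × Fin (2 * L + 1) =>
    exists_bump hs ![((m + 1 : ℕ) : ℤ),
      (if 2 * z.1.val < 2 * L + 1 then (z.1.val : ℤ) else (z.1.val : ℤ) - (2 * L + 1 : ℕ)),
      (if 2 * z.2.1.val < 2 * L + 1 then (z.2.1.val : ℤ) else (z.2.1.val : ℤ) - (2 * L + 1 : ℕ)),
      (if 2 * z.2.2.val < 2 * L + 1 then (z.2.2.val : ℤ) else (z.2.2.val : ℤ) - (2 * L + 1 : ℕ))]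
  set ψ : SchwartzMap (EuclideanSpace ℝ (Fin 4)) ℝ := ∑ z, κχ z • Bz z with hψ_def
  have hψv : ∀ y, ψ y = ∑ z, κχ z * Bz z y := fun y => sum_smul_apply κχ Bz y
  have hψsupp : tsupport (ψ : EuclideanSpace ℝ (Fin 4) → ℝ) ⊆ ⋃ z, tsupport (Bz z : EuclideanSpace ℝ (Fin 4) → ℝ) :=
    tsupport_sum_smul_subset κχ Bz
  have hψc : HasCompactSupport (ψ : EuclideanSpace ℝ (Fin 4) → ℝ) := hasCompactSupport_sum_smul κχ Bz hBc
  have hφslab : tsupport (φ : EuclideanSpace ℝ (Fin 4) → ℝ) ⊆ {y | 0 < y 0 ∧ y 0 ≤ s * ((m + 1 : ℕ) + 1)} ∧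
      tsupport (φ : EuclideanSpace ℝ (Fin 4) → ℝ) ⊆ {y | ∀ i : Fin 3, |y i.succ| < s * (L + 1 / 2)} := by
    have key := fun y (hy : y ∈ tsupport (φ : EuclideanSpace ℝ (Fin 4) → ℝ)) =>
      slab_cube hs L (m + 1) (by omega) 0 0 0 (by simp) (by simp) (by simp) (hφs hy)
    exact ⟨fun y hy => (key y hy).1, fun y hy => (key y hy).2⟩
  have hφHslab : tsupport (φH : EuclideanSpace ℝ (Fin 4) → ℝ) ⊆ {y | 0 < y 0 ∧ y 0 ≤ s * ((H : ℕ) + 1)} ∧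
      tsupport (φH : EuclideanSpace ℝ (Fin 4) → ℝ) ⊆ {y | ∀ i : Fin 3, |y i.succ| < s * (L + 1 / 2)} := by
    have key := fun y (hy : y ∈ tsupport (φH : EuclideanSpace ℝ (Fin 4) → ℝ)) =>
      slab_cube hs L H hH1 0 0 0 (by simp) (by simp) (by simp) (hφHs hy)
    exact ⟨fun y hy => (key y hy).1, fun y hy => (key y hy).2⟩
  have hψslab : tsupport (ψ : EuclideanSpace ℝ (Fin 4) → ℝ) ⊆ {y | 0 < y 0 ∧ y 0 ≤ s * ((m + 1 : ℕ) + 1)} ∧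
      tsupport (ψ : EuclideanSpace ℝ (Fin 4) → ℝ) ⊆ {y | ∀ i : Fin 3, |y i.succ| < s * (L + 1 / 2)} := by
    have key : ∀ y ∈ tsupport (ψ : EuclideanSpace ℝ (Fin 4) → ℝ),
        (0 < y 0 ∧ y 0 ≤ s * ((m + 1 : ℕ) + 1)) ∧ ∀ i : Fin 3, |y i.succ| < s * (L + 1 / 2) := by
      intro y hy
      obtain ⟨z, hz⟩ := Set.mem_iUnion.mp (hψsupp hy)
      exact slab_cube hs L (m + 1) (by omega) _ _ _ (abs_cc_le L z.1) (abs_cc_le L z.2.1) (abs_cc_le L z.2.2)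
        (hBs z hz)
    exact ⟨fun y hy => (key y hy).1, fun y hy => (key y hy).2⟩
  have hPslab := And.intro ((tsupport_add_subset' φ ψ).trans (Set.union_subset hφslab.1 hψslab.1))
    ((tsupport_add_subset' φ ψ).trans (Set.union_subset hφslab.2 hψslab.2))
  have hMslab := And.intro ((tsupport_sub_subset' φ ψ).trans (Set.union_subset hφslab.1 hψslab.1))
    ((tsupport_sub_subset' φ ψ).trans (Set.union_subset hφslab.2 hψslab.2))
  -- the small bump `v`: heights in `(0, 1 + ρ]`, spatial coordinates `≤ ρ < s(L + 1/2)`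
  have hvslab' := And.intro hvslab1 (hvcube s L (by linarith) hs)
  -- the lattice weights are read off the interpolating bumps
  have hcoef : ∀ x : FinTorusSite (2 * L + 1) (2 * L + 1) (2 * L + 1) (2 * L + 1),
      CF φ x = indT x ∧ CF ψ x = kapT x ∧ CF φH x = indH x := by
    intro x
    refine ⟨?_, ?_, ?_⟩
    · rw [hCF, hindT]
      exact read_ind_bump L (m + 1) (by omega) φ hφv x
    · rw [hCF, hkapT, hψv, hκRχ]
      exact read_kap_bumps L (m + 1) (by omega) (fun z => (Bz z : EuclideanSpace ℝ (Fin 4) → ℝ)) hBv κχ x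
    · rw [hCF, hindH]
      exact read_ind_bump L H (by omega) φH hφHv x
  -- amplitudes of the bumps
  have hAφ : ∀ n, AMP φ n = ((μ n ^ m : ℝ) : ℂ) := by
    intro n
    rw [hAMP, hφa]
    simp [Fin.sum_univ_three]
  have hAφH : ∀ n, AMP φH n = ((μ n ^ (H - 1) : ℝ) : ℂ) := by
    intro n
    rw [hAMP, hφHa]
    simp [Fin.sum_univ_three, hH1']
  have hAψ : ∀ n, AMP ψ n = ((μ n ^ m * χ (qb n) : ℝ) : ℂ) := by
    intro n
    rw [hAMP, hψ_def, hqb]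
    exact amp_kap_bumps L m hS hs (μ n) (q n) χ hsymm κχ hκχ Bz hBc hBa
  have hAadd : ∀ n, AMP (φ + ψ) n = AMP φ n + AMP ψ n := by
    intro n; rw [hAMP, hAMP, hAMP]; exact latticeSum_add φ ψ hs hφc hψc _ _
  have hAsub : ∀ n, AMP (φ - ψ) n = AMP φ n - AMP ψ n := by
    intro n; rw [hAMP, hAMP, hAMP]; exact latticeSum_sub φ ψ hs hφc hψc _ _
  have hD : ∀ n, ‖AMP (φ + ψ) n‖ ^ 2 - ‖AMP (φ - ψ) n‖ ^ 2 = 4 * (μ n ^ (2 * m) * χ (qb n)) := by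
    intro n
    rw [hAadd, hAsub, hAφ, hAψ, norm_sq_add_sub_norm_sq_sub]
    ring
  have hNH : ∀ n, ‖AMP φH n‖ ^ 2 = μ n ^ (2 * (H - 1)) := by
    intro n; rw [hAφH, norm_sq_ofReal_pow]
  -- Källén–Lehmann coherence of `f` on the physical low-pass atoms
  have hKLn : ∀ n, μ n ≤ 1 → 1 / 2 * (μ n ^ (2 * m) * χ (qb n)) * (∑' x : Fin 4 → ℤ, f (s • siteToE (d := 4) x)) ^ 2
      ≤ ‖AMP f n‖ ^ 2 := by
    intro n hμ1
    by_cases hlp : (2 / s ^ 2) * ((1 - Real.cos (2 * Real.pi * ((((q n 0) % ((2 * L + 1 : ℕ) : ℤ)).toNat : ℕ) : ℝ) /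
            ((2 * L + 1 : ℕ) : ℝ))) +
          (1 - Real.cos (2 * Real.pi * ((((q n 1) % ((2 * L + 1 : ℕ) : ℤ)).toNat : ℕ) : ℝ) / ((2 * L + 1 : ℕ) : ℝ))) +
          (1 - Real.cos (2 * Real.pi * ((((q n 2) % ((2 * L + 1 : ℕ) : ℤ)).toNat : ℕ) : ℝ) / ((2 * L + 1 : ℕ) : ℝ))))
          ≤ 1
    · have hχ1 : χ (qb n) = 1 := by rw [hχqb, if_pos hlp]
      rw [hχ1, mul_one, hAMP]
      have hcs : ∀ i : Fin 3, Real.cos (s * (2 * Real.pi * (q n i : ℝ) / (s * (2 * L + 1))))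
          = Real.cos (2 * Real.pi * ((((q n i) % ((2 * L + 1 : ℕ) : ℤ)).toNat : ℕ) : ℝ) / ((2 * L + 1 : ℕ) : ℝ)) := by
        intro i
        rw [cos_mod_eq (2 * L + 1) hS (q n i), hSR]
        congr 1
        field_simp
      have hcond : 2 / s ^ 2 * ∑ i : Fin 3, (1 - Real.cos (s * (2 * Real.pi * (q n i : ℝ) / (s * (2 * L + 1))))) ≤ 1 := by
        rw [Fin.sum_univ_three, hcs 0, hcs 1, hcs 2]
        exact hlp
      exact hKL' s (μ n) (fun i => 2 * Real.pi * (q n i : ℝ) / (s * (2 * L + 1))) f hs hs1 (hμ n) hμ1 hf0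
        hfball hcond
    · have hχ0 : χ (qb n) = 0 := by rw [hχqb, if_neg hlp]
      rw [hχ0]
      simp only [mul_zero, zero_mul]
      positivity
  -- domination of `f` by `v` on the physical atoms (DivisibleBump through `amp_dom`)
  have hdomn : ∀ n, μ n ≤ 1 → c ^ 2 * ‖AMP f n‖ ^ 2 ≤ ‖AMP v n‖ ^ 2 := by
    intro n hμ1
    have h := amp_dom v f hs hv_pos hvR hf_pos hfR (fun E hE p => hdom s hs hss₀ E hE p) (hμ n) hμ1
      (fun i => 2 * Real.pi * (q n i : ℝ) / (s * (2 * L + 1)))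
    rw [hAMP, hAMP]
    have h0 : 0 ≤ c * ‖∑' x : Fin 4 → ℤ, (((f (s • siteToE (d := 4) x) * μ n ^ (Int.toNat (x 0 - 1))) : ℝ) : ℂ) *
        cexp (I * ((s * ∑ k : Fin 3, (2 * Real.pi * (q n k : ℝ) / (s * (2 * L + 1))) * (x k.succ : ℝ) : ℝ) : ℂ))‖ :=
      mul_nonneg hc.le (norm_nonneg _)
    have h2 := pow_le_pow_left₀ h0 h 2
    rw [mul_pow] at h2
    exact h2
  -- the four `HasSum`s on the fixed hypercube
  obtain ⟨hcondP, hcondH, hcondV⟩ := heights_conditions (ρ := ρ) hs hs1 hm3 hH2 hΛρ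
  have hSV := hspecT (1 + ρ) v hcondV hvslab'.1 hvslab'.2
  have hSP := hspecT (s * ((m + 1 : ℕ) + 1)) (φ + ψ) hcondP hPslab.1 hPslab.2
  have hSMi := hspecT (s * ((m + 1 : ℕ) + 1)) (φ - ψ) hcondP hMslab.1 hMslab.2
  have hSH := hspecT (s * ((H : ℕ) + 1)) φH hcondH hφHslab.1 hφHslab.2
  have eP : CF (φ + ψ) = fun x => indT x + kapT x := by
    funext x; rw [hCFadd, (hcoef x).1, (hcoef x).2.1]
  have eM : CF (φ - ψ) = fun x => indT x - kapT x := by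
    funext x; rw [hCFsub, (hcoef x).1, (hcoef x).2.1]
  have eH : CF φH = indH := by
    funext x; exact (hcoef x).2.2
  rw [eP] at hSP
  rw [eM] at hSMi
  rw [eH] at hSH
  -- the polarised floor as a series over the family
  have hSMT : HasSum (fun n => W n * (μ n ^ (2 * m) * χ (qb n))) (QQ indT kapT) := by
    have h := (hSP.sub hSMi).div_const 4
    have hfun : (fun n => W n * (μ n ^ (2 * m) * χ (qb n))) =
        fun n => (W n * ‖AMP (φ + ψ) n‖ ^ 2 - W n * ‖AMP (φ - ψ) n‖ ^ 2) / 4 := by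
      funext n; rw [← mul_sub, hD]; ring
    have hval : (QQ (fun x => indT x + kapT x) (fun x => indT x + kapT x) -
        QQ (fun x => indT x - kapT x) (fun x => indT x - kapT x)) / 4 = QQ indT kapT := by
      rw [← hpolT indT kapT]; ring
    rw [hfun, ← hval]; exact h
  have hSNT : HasSum (fun n => W n * μ n ^ (2 * (H - 1))) (QQ indH indH) := by
    have hfun : (fun n => W n * μ n ^ (2 * (H - 1))) = fun n => W n * ‖AMP φH n‖ ^ 2 := by
      funext n; rw [hNH]
    rw [hfun]; exact hSH
  -- the abstract skeleton
  have hσ : c₀ / s ^ 4 ≤ ∑' x : Fin 4 → ℤ, f (s • siteToE (d := 4) x) := by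
    rw [div_le_iff₀ (pow_pos hs 4), mul_comm]
    exact hfl s hs hsa
  have key := glue_abstract_torus (W := W) (μ := μ) (AF := fun n => ‖AMP f n‖ ^ 2) (AV := fun n => ‖AMP v n‖ ^ 2)
    (χ := fun n => χ (qb n)) (σ := ∑' x : Fin 4 → ℤ, f (s • siteToE (d := 4) x)) (c := c) (m := m) (h := H - 1)
    hW (fun n => hμ n) (fun n => (hχ01 (qb n)).1) (fun n => (hχ01 (qb n)).2) (fun n => by positivity)
    hSV hSMT hSNT (by omega) hKLn hdomn
  -- numbers
  have hfin : c ^ 2 * c₀ ^ 2 * ε / 4 ≤ QQ (CF v) (CF v) := final_numbers hs hc₀ hε hσ hflT hclT key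
  simp only [hQQ, hCF] at hfin
  exact hfin

end Summit.QuantumFields.YangMills.Theorems.SqueezedSkewnessTorusFloorsGlue

end
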